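import Summits.QuantumAdvantage.QuantumAdvantage.Theorems.GaugeDialLawsA
import Literature.Computability.QuantumComplexity.IQPForrelation

/-! # GaugeDialLaws — part 2/2 (mechanical split for landing of `GaugeDialLaws`; content verbatim; scopes re-opened with their variables) -/

set_option linter.dupNamespace false
noncomputable section

namespace Summit.QuantumAdvantage.QuantumAdvantage.Theorems.GaugeDial
open Finset
open Literature.Computability.Complexity
open Literature.Computability.QuantumComplexity
open Literature.ModelTheory.FiniteModelTheory
open Summit.QuantumAdvantage.QuantumAdvantage.Theses.AnfPresentation
open Summit.QuantumAdvantage.QuantumAdvantage.Theorems.PebbleDial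

section Rails
variable {m : ℕ}

/-- re-twisting the homogeneous companion and re-twisting the instance commute with `homog` trivially:
`(I^{x₀})⁰ = I⁰`. -/
theorem homog_flipAt (x₀ : Fin m) (I : Xor3.Instance (Fin m)) : (flipAt x₀ I).homog = I.homog := by
  simp only [flipAt, Xor3.Instance.homog, Multiset.map_map, Function.comp_def, flipEq]

end Rails


/-! ## §3 The split beneath `FoolingPairs` in the rail language: CARRIER (algebra) ∧ INVISIBILITY (finite model theory) -/

section Split

variable {m : ℕ}

/-- [dictionary] a base table FIXED, as a table, by every rail swap (so Duplicator's rail swaps never disturb it).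
LAW (pen-and-paper, §5 of the header): such tables present exactly the cubic polynomials in the rail sums
`s_e = x_e⁰ ⊕ x_e¹` — never a product `x_e⁰x_e¹`. -/
def SwapInvariant (base : CubicForm (m * 2)) : Prop := ∀ x₀ : Fin m, permForm (railSwap x₀) base = base

/-- [piece · finite model theory · T-free · ATTACKABLE now] `RailInvisible k`: over swap-invariant bases, a
`k`-LOCALLY SATISFIABLE twist system `J` and its homogeneous companion `J⁰` have `C^k`-equivalent rail-form instances.
This is Atserias–Dawar 2019 Lemma 2 (tree, PROVED for the doubled 3-XOR structures:
`FiniteModelTheory.Xor3.Instance.IsLocallySat.ckEquiv_double`) run on ANF tables: Duplicator's bijections are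
products of rail swaps `railSwap x` over the rails her local assignment sets to `1`; the gauge law
`permForm_railSwap_railForm` and `SwapInvariant` are exactly what the partial-isomorphism check consumes.
WHY IT MIGHT FAIL: only through a slip in the typing (constants: both tables have constant `base.const`; repeated
rails in an equation are allowed and behave as in the 3-XOR semantics). -/
def RailInvisible (k : ℕ) : Prop :=
  ∀ (m : ℕ) (base base' : CubicForm (m * 2)), SwapInvariant base → SwapInvariant base' →
    ∀ J : Xor3.Instance (Fin m), J.IsLocallySat k →
      CkEquivANF k (railForm base J.homog) (railForm base' J.homog) (railForm base J) (railForm base' J)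

/-- [piece · algebra of cubic forms · T-free · INSTRUMENTED → FALSE for every `k` by the RAIL NO-GO (header; the
algebraic core is certified: `twist_partner_sign`, §4b; the table bookkeeping is pen-and-paper)] `RailCarrier k`: for
unboundedly many rails there is a `k`-locally satisfiable twist system whose untwisted rail-form instance is exact `+1`
and whose twisted one is exact `-1` (over swap-invariant bases, one base per side).  The no-go in one breath: a
swap-invariant table presents only polynomials in the rail sums, so both rail forms are Maiorana–McFarland
`⟨a, Λ(s)⟩ ⊕ ψ(s)` with `Λ 0 = 0`, and twisting adds the SAME `h_U(s)` (`h_U 0 = 0`) to `F` and to `G`; exact `+1`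
makes `G⁰` the dual of `F⁰`; the dual of `F⁰ ⊕ h_U` is `G⁰ ⊕ h_U∘Λ⁻¹`, the gauge partner is `G⁰ ⊕ h_U`, and the two can
differ by the constant `1` (value `-1`) only if `h_U(Λ⁻¹ 0) = h_U 0 ⊕ 1`, i.e. `0 = 1`.  Kept typed: `¬ RailCarrier k`
is a cheap Theorems-grade negative for the cell (not yet in the tree). -/
def RailCarrier (k : ℕ) : Prop :=
  ∀ n₀ : ℕ, ∃ m, n₀ ≤ m ∧ ∃ base base' : CubicForm (m * 2), SwapInvariant base ∧ SwapInvariant base' ∧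
    ∃ J : Xor3.Instance (Fin m), J.IsLocallySat k ∧
      (⟨m * 2, railForm base J.homog, railForm base' J.homog⟩ : CubicANFPair).value = 1 ∧
      (⟨m * 2, railForm base J, railForm base' J⟩ : CubicANFPair).value = -1

/-- ★ [split law, PROVED] CARRIER ∧ INVISIBILITY ⟹ FOOLING PAIRS (arity `2m` is even for free: doubled rails). -/
theorem foolingPairs_of_rails {k : ℕ} (hI : RailInvisible k) (hC : RailCarrier k) : FoolingPairs k := by
  intro n₀
  obtain ⟨m, hm, base, base', hb, hb', J, hJ, h₁, h₂⟩ := hC n₀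
  exact ⟨m * 2, by omega, ⟨m, by ring⟩, _, _, _, _, hI m base base' hb hb' J hJ, h₁, h₂⟩

/-- the same split read through the EQUIV: rail data are a signed gauge system as soon as they carry. -/
theorem gaugeFooling_of_rails {k : ℕ} (hI : RailInvisible k) (hC : RailCarrier k) : GaugeFooling k :=
  (gaugeFooling_iff_foolingPairs k).2 (foolingPairs_of_rails hI hC)

/-- [line] the rail split feeds the symmetric rung of `PebbleDial` (tree): supports + rails ⟹ `SymRungNU` ⟹ `SymRung`. -/
theorem symRung_of_rails (hS : SupportTheoremANF) (hI : ∀ k, RailInvisible k) (hC : ∀ k, RailCarrier k) : SymRung :=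
  symRung_of_foolingPairs hS fun k => foolingPairs_of_rails (hI k) (hC k)

end Split

/-! ## §4 CARRIERS EXIST ONE STEP OUTSIDE THE TABLE GAUGE: blow-up keys are involutions (certified), hence exact pairs

The instrument (`aux/hyper_search.py`, `aux/octa_analyze.py`) found bent cubic rail-type functions with cubic duals
exactly on BLOW-UPS (octahedron `K_{2,2,2}`: 13 bijective keys, 1 with quadratic inverse; `K_{2,2,2,2}`: 25 / 1;
Fano plane: 49 / 0; every 2-regular system on `K₄, K_{3,3}`, prism, `Q₃`, Petersen and every gadget cycle of length
`≤ 6`: 0).  The mechanism, certified here for ALL blow-ups at once: rails come in pairs `i, ī`, the quadratic part of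
the key depends on the rail sums only through the PAIR SUMS `s_i ⊕ s_ī`, which the key `Λ_i = 1 ⊕ s_i ⊕ Q_i` leaves
invariant — so `Λ ∘ Λ = id`, and `(⟨x, Λ y⟩ ⊕ h y, ⟨Λ u, w⟩ ⊕ h (Λ u))` is an exact `+1` pair for every offset `h`
(tree: `FlatDial.isDualOf_mmFun`).  The affine term `1 ⊕ s_i` of the key is the wire product `x_i⁰x_i¹` — precisely
the term a swap-covariant TABLE cannot present (§3): the carriers live one step outside the rail-form gauge. -/

section Carriers

variable {r : ℕ}

/-- [dictionary] a BLOW-UP KEY on `r` rail sums: a pairing `bar` of the rails and a quadratic-part recipe `Q`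
that reads the rail sums only through the pair sums and does not distinguish a rail from its partner. -/
structure BlowupKey (r : ℕ) where
  /-- the partner of a rail (an involution; fixed points allowed) -/
  bar : Fin r → Fin r
  bar_bar : ∀ i, bar (bar i) = i
  /-- the quadratic part of the key -/
  Q : (Fin r → Bool) → Fin r → Bool
  Q_congr : ∀ s s' : Fin r → Bool, (∀ i, xor (s i) (s (bar i)) = xor (s' i) (s' (bar i))) → Q s = Q s'
  Q_bar : ∀ s i, Q s (bar i) = Q s i

/-- [dictionary] the key `Λ_i(s) = 1 ⊕ s_i ⊕ Q_i(s)`. -/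
def BlowupKey.key (K : BlowupKey r) (s : Fin r → Bool) : Fin r → Bool := fun i => xor (!s i) (K.Q s i)

/-- ★ [carrier law, PROVED] every blow-up key is an INVOLUTION (pair sums are invariant under the key). -/
theorem BlowupKey.key_key (K : BlowupKey r) (s : Fin r → Bool) : K.key (K.key s) = s := by
  have hQ : K.Q (K.key s) = K.Q s := K.Q_congr _ _ fun i => by
    show xor (xor (!s i) (K.Q s i)) (xor (!s (K.bar i)) (K.Q s (K.bar i))) = xor (s i) (s (K.bar i))
    rw [K.Q_bar]
    cases s i <;> cases s (K.bar i) <;> cases K.Q s i <;> rfl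
  funext i
  show xor (!(xor (!s i) (K.Q s i))) (K.Q (K.key s) i) = s i
  rw [hQ]
  cases s i <;> cases K.Q s i <;> rfl

/-- ★ [carrier law, PROVED via tree `FlatDial.isDualOf_mmFun`] the Maiorana–McFarland pair on a blow-up key is EXACT:
`⟨x, Λ y⟩ ⊕ h y` is bent with dual `⟨Λ u, w⟩ ⊕ h (Λ u)` — for every blow-up key and every offset `h`
(cubic with cubic dual when `Q` is quadratic in the pair sums and `h` is a suitable cubic; degrees not tracked here). -/
theorem BlowupKey.isDualOf (K : BlowupKey r) (h : (Fin r → Bool) → Bool) :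
    Theorems.HintDial.IsDualOf (Theorems.FlatDial.mmFun K.key h) (Theorems.FlatDial.mmDualFn K.key h) :=
  Theorems.FlatDial.isDualOf_mmFun K.key_key K.key_key

/-- the exact value `+1` of the blow-up pair. -/
theorem BlowupKey.forrelation_eq_one (K : BlowupKey r) (h : (Fin r → Bool) → Bool) :
    forrelation (Theorems.FlatDial.mmFun K.key h) (Theorems.FlatDial.mmDualFn K.key h) = 1 :=
  Theorems.FlatDial.forrelation_mmFun_mmDualFn K.key_key K.key_key

/-- [dictionary] the blow-up key of a BLOCK DESIGN: rails grouped into blocks (`blk`, constant on partners) and any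
recipe `q` reading the vector of pair sums and the block — e.g. the octahedron: `r = 6`, `bar` the antipode,
`blk` the three axes, `q σ P = Σ_{P' ≠ P'' ≠ P} σ_{P'}σ_{P''}` (the eight faces of `K_{2,2,2}` as gadgets). -/
def blockKey {β : Type} (bar : Fin r → Fin r) (hbar : ∀ i, bar (bar i) = i) (blk : Fin r → β)
    (hblk : ∀ i, blk (bar i) = blk i) (q : (Fin r → Bool) → β → Bool) : BlowupKey r where
  bar := bar
  bar_bar := hbar
  Q s i := q (fun j => xor (s j) (s (bar j))) (blk i)
  Q_congr s s' h := by
    funext i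
    simp only [funext h]
  Q_bar s i := by simp only [hblk]

end Carriers

/-! ## §4b ROOT LAW (certified): without 1-variable gadgets («pins») no twist flips the sign

In every table-gauge design the key `Λ` and every gadget twist are polynomials in the rail sums WITHOUT constant
term unless the design contains 1-variable gadgets (pins: the only covariant cells presenting a bare wire `x_e⁰`).
Then `Λ 0 = 0`, the root `Λ⁻¹ 0` is `0`, and the dual's origin bit — which decides the dominant sign
(`PebbleDial.value_eq_one_iff_const_eq_domBit`) — is `h (Λ⁻¹ 0) = h 0`, the same for every twist `h' = h ⊕ s_xs_ys_z`.
Instrument (`aux/anchored_*.out`): WITH pins, among `208` sign-flipping twists keeping the pair in the cubic slice,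
`206` have all three rails and `2` have two rails 2-XOR-chained to a pin (Spoiler walks such a chain with three
pebbles), and the hand-built pin-free-component flipper has inverse degree `3`, i.e. QUARTIC duals — the
«ANCHOR–QUARTIC DICHOTOMY», not certified. -/

section RootLaw

variable {k : ℕ}

open Summit.QuantumAdvantage.QuantumAdvantage.Theorems.HintDial.Automaton (bd) in
/-- ★ [root law, PROVED] the Maiorana–McFarland dual at the origin is the offset at the root `σ 0`. -/
theorem mmDualFn_origin (σ : (Fin k → Bool) → (Fin k → Bool)) (h : (Fin k → Bool) → Bool) :
    Theorems.FlatDial.mmDualFn σ h (fun _ => false) = h (σ fun _ => false) := by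
  simp [Theorems.FlatDial.mmDualFn, bd]

/-- ★ [root law, PROVED] if the inverse key fixes `0` (no pins) then two offsets that agree at `0` — e.g. `h` and
`h ⊕ s_xs_ys_z` — have duals with the SAME origin bit: the twist cannot flip the dominant sign. -/
theorem mmDualFn_origin_eq_of_root {σ : (Fin k → Bool) → (Fin k → Bool)} (hσ : σ (fun _ => false) = fun _ => false)
    {h h' : (Fin k → Bool) → Bool} (h0 : h (fun _ => false) = h' (fun _ => false)) :
    Theorems.FlatDial.mmDualFn σ h (fun _ => false) = Theorems.FlatDial.mmDualFn σ h' (fun _ => false) := by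
  rw [mmDualFn_origin, mmDualFn_origin, hσ, h0]

/-- the cubic gadget twist `s_x s_y s_z` vanishes at the root `0` (so `mmDualFn_origin_eq_of_root` applies to it). -/
theorem twist_at_zero (x y z : Fin k) (h : (Fin k → Bool) → Bool) :
    (fun s : Fin k → Bool => xor (h s) (s x && s y && s z)) (fun _ => false) = h (fun _ => false) := by
  simp

/-- ★ [twist-partner law, PROVED] the dual of a TWISTED Maiorana–McFarland function `⟨x, π y⟩ ⊕ h y ⊕ t y` is the
old dual re-twisted by `t ∘ σ` — NOT by `t`. -/
theorem mmDualFn_twist (σ : (Fin k → Bool) → (Fin k → Bool)) (h t : (Fin k → Bool) → Bool) (y₁ y₂ : Fin k → Bool) :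
    Theorems.FlatDial.mmDualFn σ (fun s => xor (h s) (t s)) (Fin.append y₁ y₂) =
      xor (Theorems.FlatDial.mmDualFn σ h (Fin.append y₁ y₂)) (t (σ y₁)) := by
  rw [Theorems.FlatDial.mmDualFn_append, Theorems.FlatDial.mmDualFn_append, Bool.xor_assoc]

/-- ★ [twist-partner law, PROVED] the GAUGE partner of the twisted function is the old partner re-twisted by the SAME
`t` (both tables are rail forms of the same twisted instance) up to an atomic constant `c` (the sign).  If that
partner is the dual — i.e. the twisted pair is exact — then, as soon as the key fixes `0` and the twist vanishes at
`0` (no pins: every affine-XOR rail design), `c = false`: the twisted pair has the SAME sign as the untwisted one.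
This is the algebraic core of `¬ RailCarrier k` for EVERY `k`. -/
theorem twist_partner_sign {σ : (Fin k → Bool) → (Fin k → Bool)} (hσ : σ (fun _ => false) = fun _ => false)
    {h t : (Fin k → Bool) → Bool} (ht : t (fun _ => false) = false) {c : Bool}
    (H : ∀ y₁ y₂, Theorems.FlatDial.mmDualFn σ (fun s => xor (h s) (t s)) (Fin.append y₁ y₂) =
      xor (xor (Theorems.FlatDial.mmDualFn σ h (Fin.append y₁ y₂)) (t y₁)) c) : c = false := by
  have H0 := H (fun _ => false) (fun _ => false)
  rw [mmDualFn_twist, hσ, ht] at H0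
  revert H0
  cases Theorems.FlatDial.mmDualFn σ h (Fin.append (fun _ => false) (fun _ => false)) <;> cases c <;> simp

end RootLaw

/-! ## §4c ★ DIAGONAL LAW / SIGN RIGIDITY (certified): the dominant sign of an exact table is its value on the diagonal

Read a form on doubled rails as `F(u,v)` (`u` = the copy-0 layer, `v` = the copy-1 layer).  On the DIAGONAL `{u = v}` every
covariant gadget with an EVEN number of cells vanishes (each cell evaluates to the product of its letters), and a
swap-invariant base `ψ(s)` is the constant `ψ 0`; the only covariant cell families with an ODD number of cells have trivial
stabiliser (`|V|` divides the number of cells) — they are ANCHORS (pins, rigid patterns), on which Duplicator has no freedom.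
So in every anchor-free covariant table gauge — XOR 3-gadgets and 2-gadgets, EQUALITY gadgets `{c, c ⊕ 𝟙}` (the one non-pinning
AND-pattern), any mixture, any invariant base — ALL members take the SAME constant value `c₀` on the diagonal.
★ `sign_rigidity` (Parseval on the diagonal characters, three lines): if `Ŵ_F(b,b)² = 4^L` for all `b` (true for bent `F`)
and `F ≡ c₀` on the diagonal, then `Σ_x (−1)^{F x} = 2^L·(−1)^{c₀}`: the dominant sign IS the diagonal value.  Hence NO
anchor-free covariant table gauge contains a fooling pair (exact `+1` and exact `−1` members): this subsumes the root law
(§4b, pins = the anchors of the XOR gauge), kills the equality-gadget gauges and all mixed gauges at once, and leaves exactly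
the instrumented question of §Instrument — can a twist far from every anchor flip the sign (ANCHOR–QUARTIC DICHOTOMY, 299/299 no). -/

section SignRigidity

open Literature.Computability.QuantumComplexity.BuzetChailloux (bxor bxorPerm bxorPerm_apply bxor_bxor_cancel_left)
open Literature.Computability.QuantumComplexity.DerivativeWalsh (W sum_W_sq)

variable {L : ℕ}

/-- The layer-difference sums `S_F(w) = Σ_u (−1)^{F(u, u ⊕ w)}` (`S_F 0` is the diagonal sum). -/
def diagSum (F : (Fin L → Bool) → (Fin L → Bool) → Bool) (w : Fin L → Bool) : ℝ :=
  ∑ u, signOf (F u (bxor u w))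

/-- GaugeDialLaws helper `twist_zero_right'` (decomp-qadv land package; see the module docstring). -/
theorem twist_zero_right' (x : Fin L → Bool) : twist x (fun _ => false) = 1 := by
  unfold twist; simp

/-- GaugeDialLaws helper `bxor_zero_right` (decomp-qadv land package; see the module docstring). -/
theorem bxor_zero_right (u : Fin L → Bool) : bxor u (fun _ => false) = u := by
  funext i; simp [bxor]

/-- The Walsh coefficient of `F` at a DIAGONAL character `(b,b)` is the Walsh coefficient of `S_F` at `b`. -/
theorem walsh_diag_eq_W (F : (Fin L → Bool) → (Fin L → Bool) → Bool) (b : Fin L → Bool) :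
    ∑ u, ∑ v, signOf (F u v) * twist (bxor u v) b = W (diagSum F) b := by
  unfold W diagSum
  calc ∑ u, ∑ v, signOf (F u v) * twist (bxor u v) b
      = ∑ u, ∑ w, signOf (F u (bxor u w)) * twist w b := by
          refine sum_congr rfl fun u _ => ?_
          rw [← Equiv.sum_comp (bxorPerm u) (fun v => signOf (F u v) * twist (bxor u v) b)]
          simp only [bxorPerm_apply, bxor_bxor_cancel_left]
    _ = ∑ w, ∑ u, signOf (F u (bxor u w)) * twist w b := sum_comm
    _ = ∑ w, (∑ u, signOf (F u (bxor u w))) * twist w b := by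
          refine sum_congr rfl fun w _ => ?_
          rw [sum_mul]

/-- GaugeDialLaws helper `card_layer` (decomp-qadv land package; see the module docstring). -/
theorem card_layer : (Fintype.card (Fin L → Bool) : ℝ) = (2 : ℝ) ^ L := by
  rw [Fintype.card_fun, Fintype.card_bool, Fintype.card_fin]; push_cast; rfl

/-- ★ SIGN RIGIDITY (diagonal law).  If `F` on doubled rails is flat on the diagonal characters (`Ŵ_F(b,b)² = 4^L`, e.g. `F`
bent) and constant `= c₀` on the diagonal `{u = v}`, then `Σ_{u,v} (−1)^{F(u,v)} = 2^L (−1)^{c₀}`: the dominant sign of `F`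
is its diagonal value.  Proof: `Ŵ_F(b,b) = Ŵ_{S_F}(b)`; Parseval gives `Σ_w S_F(w)² = 4^L = S_F(0)²`, so `S_F(w) = 0` for
`w ≠ 0` and `Σ (−1)^F = Σ_w S_F(w) = S_F(0)`. -/
theorem sign_rigidity (F : (Fin L → Bool) → (Fin L → Bool) → Bool) (c₀ : Bool) (hdiag : ∀ u, F u u = c₀)
    (hflat : ∀ b, (∑ u, ∑ v, signOf (F u v) * twist (bxor u v) b) ^ 2 = (2 : ℝ) ^ (L + L)) :
    ∑ u, ∑ v, signOf (F u v) = (2 : ℝ) ^ L * signOf c₀ := by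
  set z : Fin L → Bool := fun _ => false with hz
  have hP := sum_W_sq (diagSum F)
  have h1 : ∑ b, W (diagSum F) b ^ 2 = (2 : ℝ) ^ L * (2 : ℝ) ^ (L + L) := by
    simp_rw [← walsh_diag_eq_W, hflat]
    rw [sum_const, card_univ, nsmul_eq_mul, card_layer]
  have h2 : ∑ w, diagSum F w ^ 2 = (2 : ℝ) ^ (L + L) := by
    rw [h1] at hP
    exact (mul_left_cancel₀ (by positivity) hP).symm
  have h0 : diagSum F z = (2 : ℝ) ^ L * signOf c₀ := by
    unfold diagSum
    simp_rw [hz, bxor_zero_right, hdiag]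
    rw [sum_const, card_univ, nsmul_eq_mul, card_layer]
  have hsq0 : diagSum F z ^ 2 = (2 : ℝ) ^ (L + L) := by
    rw [h0, mul_pow, Literature.Computability.QuantumComplexity.BuzetChailloux.signOf_sq, mul_one, ← pow_mul, pow_add]; ring
  have hsplit := add_sum_erase univ (fun w => diagSum F w ^ 2) (mem_univ z)
  have hrest : ∑ w ∈ univ.erase z, diagSum F w ^ 2 = 0 := by linarith
  have hzero : ∀ w, w ≠ z → diagSum F w = 0 := by
    intro w hw
    have hmem : w ∈ univ.erase z := mem_erase.mpr ⟨hw, mem_univ w⟩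
    have := (sum_eq_zero_iff_of_nonneg (fun w _ => sq_nonneg (diagSum F w))).mp hrest w hmem
    exact (pow_eq_zero_iff two_ne_zero).mp this
  have htot : ∑ u, ∑ v, signOf (F u v) = ∑ w, diagSum F w := by
    have e := walsh_diag_eq_W F z
    simp only [hz, twist_zero_right', mul_one] at e
    rw [e]; unfold W
    refine sum_congr rfl fun w _ => ?_
    rw [twist_zero_right', mul_one]
  rw [htot, ← add_sum_erase univ (fun w => diagSum F w) (mem_univ z),
    sum_eq_zero (fun w hw => hzero w (mem_erase.mp hw).1), add_zero, h0]

/-- Corollary (no fooling pair in an anchor-free gauge): two tables flat on the diagonal characters with the SAME diagonal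
constant have the SAME dominant sign. -/
theorem dominant_sign_eq_of_diag (F F' : (Fin L → Bool) → (Fin L → Bool) → Bool) (c₀ : Bool)
    (hd : ∀ u, F u u = c₀) (hd' : ∀ u, F' u u = c₀)
    (hF : ∀ b, (∑ u, ∑ v, signOf (F u v) * twist (bxor u v) b) ^ 2 = (2 : ℝ) ^ (L + L))
    (hF' : ∀ b, (∑ u, ∑ v, signOf (F' u v) * twist (bxor u v) b) ^ 2 = (2 : ℝ) ^ (L + L)) :
    ∑ u, ∑ v, signOf (F u v) = ∑ u, ∑ v, signOf (F' u v) := by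
  rw [sign_rigidity F c₀ hd hF, sign_rigidity F' c₀ hd' hF']

end SignRigidity

/-- [summary] the certified content of the node in one statement. -/
theorem gaugeDial_summary :
    (∀ k, GaugeFooling k ↔ FoolingPairs k) ∧
    (∀ {n q m : ℕ} (S : SignedGaugeSystem n q m) (e : Fin m), Even (S.st e).card) ∧
    (∀ {m : ℕ} (x₀ : Fin m) (base : CubicForm (m * 2)) (I : Xor3.Instance (Fin m)),
      permForm (railSwap x₀) base = base → permForm (railSwap x₀) (railForm base I) = railForm base (flipAt x₀ I)) ∧
    (∀ k, RailInvisible k → RailCarrier k → FoolingPairs k) ∧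
    (∀ {r : ℕ} (K : BlowupKey r) (h : (Fin r → Bool) → Bool),
      forrelation (Theorems.FlatDial.mmFun K.key h) (Theorems.FlatDial.mmDualFn K.key h) = 1) ∧
    (∀ {L : ℕ} (F : (Fin L → Bool) → (Fin L → Bool) → Bool) (c₀ : Bool), (∀ u, F u u = c₀) →
      (∀ b, (∑ u, ∑ v, signOf (F u v) * twist (BuzetChailloux.bxor u v) b) ^ 2 = (2 : ℝ) ^ (L + L)) →
      ∑ u, ∑ v, signOf (F u v) = (2 : ℝ) ^ L * signOf c₀) :=
  ⟨gaugeFooling_iff_foolingPairs, fun S e => S.even_card_star e,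
    fun x₀ _ I hb => permForm_railSwap_railForm x₀ hb I, fun _ hI hC => foolingPairs_of_rails hI hC,
    fun K h => K.forrelation_eq_one h, fun F c₀ hd hf => sign_rigidity F c₀ hd hf⟩

end Summit.QuantumAdvantage.QuantumAdvantage.Theorems.GaugeDial

end
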